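import Mathlib.MeasureTheory.Constructions.Pi
import Mathlib.MeasureTheory.Measure.Prod
import Mathlib.MeasureTheory.Group.MeasurableEquiv
import Mathlib.MeasureTheory.Integral.IntervalIntegral.Basic
import Literature.Analysis.FluidPDE.HardSpherePhaseSpaceProofs
import Literature.Analysis.FluidPDE.HardSphereTranslation
import Summits.AtomisticToContinuum.HydrodynamicLimit.Theorems.AntiMazurCoboundariesKineticWindowGronwallBoostTrajectory
import HarnessLib

/-!
# Galilean boosts of hard-sphere flows on the torus (helper, layer 2: flows and the Liouville measure)

Crux `Summit.AtomisticToContinuum.HydrodynamicLimit.Theses.AntiMazurCoboundaries.KineticWindowGronwall`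
(stmt-AtomisticToContinuum-9282), line `dlr-block-transfer` v6, helper toward the stub `stub_boostFlow` of the lead's
stub `stub_frameCovariance` (layer 2 of the Galilean boost). Layer 1 (`…KineticWindowGronwallBoostTrajectory`: `boostAt u t z = (x_i + t u, v_i + u)_i` and
`isHardSphereTrajectory_boostAt`) is the trajectory-level symmetry; this file lifts it to FLOWS (`HardSphereDynamics`:
good set, group law, measurable Liouville-preserving time-`t` maps whose good orbits are hard-sphere trajectories),
following the thermal-scaling template `…KineticWindowGronwallThermalScalingFlow` (`thermalScale`).

THE CONSTRUCTION. For a hard-sphere flow `Φ` on `𝕋ᵈ` and `u ∈ ℝᵈ` the BOOSTED FLOW `boost Φ u _` has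
`flow t z := boostAt u t (Φ.flow t (boostAt (-u) 0 z))`, `good := boostAt (-u) 0 ⁻¹' Φ.good = boostAt u 0 '' Φ.good`:
start from `z`, remove the drift (`boostAt (-u) 0`, the velocity translation by `-u`), run `Φ` for time `t`, and put
the drift back at time `t` (`boostAt u t`: velocities `+ u`, positions `+ t u`).

THE HYPOTHESIS (why `boost` is not unconditional, unlike `thermalScale`). The conjugating maps `boostAt u t` DEPEND ON
TIME, so `t ↦ boostAt u t ∘ Φ_t ∘ boostAt (-u) 0` is a one-parameter group on `boostAt u 0 '' Φ.good` iff `Φ` commutes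
ON ITS GOOD SET with the position translations `boostAt (-u) 0 ∘ boostAt u t = (x_i ↦ x_i + t u)`
(`boostAt_neg_zero_boostAt`) and the good set is invariant under them: the group law reads
`Φ_s (τ_{tu} (Φ_t w)) = τ_{tu} (Φ_s (Φ_t w))`. For the abstract hypothesis structure `HardSphereFlow` (arbitrary
conull good set, junk values off it) this is FALSE in general — e.g. `N = 1`, `d = Fin 2`: free flight frozen
(`flow t z := z`) on the null invariant set `S = {(x, v) | x ∈ x₀ + ℝ v}` with good set `Sᶜ` is a `HardSphereFlow`,
and for `u ≠ 0` NO `HardSphereFlow Ψ` has `Ψ.flow t z = boostAt u t (Φ.flow t (boostAt (-u) 0 z))` for all `t, z`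
(for a.e. `w = (x, v)` the translate `τ_{tu} (Φ_t w)` lies in `S` for some `t`, after which the conjugate orbit is
frozen in a moving frame and violates the group law, so `Ψ.good` would be null). Translation invariance of the good
set is exactly what makes it work: by forward uniqueness of hard-sphere trajectories
(`HardSphereFlow.flow_posShift_of_nonneg/neg`, `HardSphereTranslation`) a flow whose good set is invariant under all
position translations commutes with them on the good set (`flow_posShift_of_good`). The canonical (Alexander) flow has
this property; an arbitrary flow agrees with such a flow only Liouville-a.e.

MEASURE THEORY. `boostAt u t` is the product over the particles of `(x, v) ↦ (x + t u, v + u)`, a translation of the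
compact group `𝕋ᵈ` (Haar measure) times a translation of `ℝᵈ` (Lebesgue measure), so it preserves `volume`
(`measurePreserving_boostAt_volume`) and, the hard-sphere domain being boost-invariant, the Liouville measure
(`measurePreserving_boostAt_liouville`); `boost Φ u _` preserves Liouville as the composition of three such maps.

CONTENTS: `measurePreserving_boostAt_volume/liouville`, `boostEquiv`, `flow_posShift_of_good`, the structure `boost`
and its dictionary (`boost_flow`, `boost_good(_eq_image)`, `mem_boost_good_iff`, `boost_flow_boostAt`, `boost_orbit`,
`boost_good_posShift` (boosts iterate), `lawAt_boost_map`, `map_boostAt_boost_good_compl`,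
`intervalIntegral_boost_flow`), the statement `BoostFlowOfInvariantGood` (the corrected, exact form of the lead's
registered `BoostFlow`, with the translation-invariance hypothesis) and its proof `boostFlow_of_invariantGood`, the
torus-`Fin 3` form `boostFlow_torus`.
-/

noncomputable section

open Set Filter Function MeasureTheory
open scoped ENNReal
open Literature.Analysis
open Literature.Analysis.FluidPDE

namespace Summit.AtomisticToContinuum.HydrodynamicLimit.Theorems.KineticWindowGronwallBoost

section Measure

variable {d : Type*} [Fintype d] {N : ℕ}

/-- **The boost preserves Lebesgue measure** on the torus phase space `(𝕋ᵈ × ℝᵈ)^N`: factor by factor it is the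
translation `x ↦ x + t u` of the compact group `𝕋ᵈ` times the translation `v ↦ v + u` of `ℝᵈ` (invariance of Haar
and Lebesgue measure). [folklore] -/
theorem measurePreserving_boostAt_volume (u : EuclideanSpace ℝ d) (t : ℝ) :
    MeasurePreserving (boostAt u t : Config N d (UnitAddTorus d) → Config N d (UnitAddTorus d)) volume volume := by
  have h1 : MeasurePreserving (fun p : UnitAddTorus d × EuclideanSpace ℝ d =>
      (p.1 + FunctionSpaces.Torus.proj (t • u), p.2 + u)) volume volume :=
    (measurePreserving_add_right (volume : Measure (UnitAddTorus d)) _).prod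
      (measurePreserving_add_right (volume : Measure (EuclideanSpace ℝ d)) u)
  haveI : SigmaFinite (volume : Measure (UnitAddTorus d × EuclideanSpace ℝ d)) := inferInstance
  exact measurePreserving_pi (fun _ : Fin N => (volume : Measure (UnitAddTorus d × EuclideanSpace ℝ d)))
    (fun _ : Fin N => (volume : Measure (UnitAddTorus d × EuclideanSpace ℝ d))) (fun _ => h1)

/-- `boostAt u t` as a measurable automorphism of phase space (inverse `boostAt (-u) t`). -/
def boostEquiv (u : EuclideanSpace ℝ d) (t : ℝ) : Config N d (UnitAddTorus d) ≃ᵐ Config N d (UnitAddTorus d) where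
  toFun := boostAt u t
  invFun := boostAt (-u) t
  left_inv := boostAt_neg_boostAt u t
  right_inv := boostAt_boostAt_neg u t
  measurable_toFun := measurable_boostAt u t
  measurable_invFun := measurable_boostAt (-u) t

/-- Unfolding lemma for `boostEquiv`. [folklore] -/
@[simp]
theorem coe_boostEquiv (u : EuclideanSpace ℝ d) (t : ℝ) : ⇑(boostEquiv (N := N) u t) = boostAt u t := rfl

/-- The inverse of `boostEquiv u t` is the boost by `-u`. [folklore] -/
@[simp]
theorem coe_boostEquiv_symm (u : EuclideanSpace ℝ d) (t : ℝ) : ⇑(boostEquiv (N := N) u t).symm = boostAt (-u) t := rfl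

/-- **The boost preserves the Liouville measure** (it preserves Lebesgue measure and the hard-sphere domain). [folklore] -/
theorem measurePreserving_boostAt_liouville (ε : ℝ) (u : EuclideanSpace ℝ d) (t : ℝ) :
    MeasurePreserving (boostAt u t : Config N d (UnitAddTorus d) → Config N d (UnitAddTorus d))
      (liouville (Torus.geometry d) N ε) (liouville (Torus.geometry d) N ε) := by
  have hvol : MeasurePreserving (boostEquiv (N := N) u t) volume volume := measurePreserving_boostAt_volume u t
  have key := hvol.restrict_preimage_emb (boostEquiv u t).measurableEmbedding
    (hardSphereDomain (Torus.geometry d) N ε)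
  have hpre : (boostEquiv (N := N) u t) ⁻¹' hardSphereDomain (Torus.geometry d) N ε =
      hardSphereDomain (Torus.geometry d) N ε := preimage_boostAt_hardSphereDomain ε u t
  rw [hpre] at key
  rw [liouville_eq]
  exact key

/-- The push-forward form: `(boostAt u t)_# liouville = liouville`. [folklore] -/
theorem map_boostAt_liouville (ε : ℝ) (u : EuclideanSpace ℝ d) (t : ℝ) :
    (liouville (Torus.geometry d) N ε).map (boostAt u t) = liouville (Torus.geometry d) N ε :=
  (measurePreserving_boostAt_liouville ε u t).map_eq

/-- The boost preserves Liouville-null sets. [folklore] -/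
theorem liouville_preimage_boostAt_eq_zero (ε : ℝ) (u : EuclideanSpace ℝ d) (t : ℝ)
    {s : Set (Config N d (UnitAddTorus d))} (hs : MeasurableSet s) (h0 : liouville (Torus.geometry d) N ε s = 0) :
    liouville (Torus.geometry d) N ε (boostAt u t ⁻¹' s) = 0 := by
  rw [(measurePreserving_boostAt_liouville ε u t).measure_preimage hs.nullMeasurableSet, h0]

/-- Liouville-almost every configuration has its inverse-boost in a given conull set. [folklore] -/
theorem ae_boostAt_mem (ε : ℝ) (u : EuclideanSpace ℝ d) (t : ℝ) {s : Set (Config N d (UnitAddTorus d))}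
    (hs : MeasurableSet s) (h0 : liouville (Torus.geometry d) N ε sᶜ = 0) :
    ∀ᵐ z ∂liouville (Torus.geometry d) N ε, boostAt u t z ∈ s := by
  rw [ae_iff]
  exact liouville_preimage_boostAt_eq_zero ε u t hs.compl h0

end Measure

/-! ### Position translations and the boosted flow -/

section Flow

variable {d : Type*} [Fintype d] {N : ℕ} {ε : ℝ}

/-- A boost at time `s` of a configuration translated by `t u` is the boost at time `s + t`. [folklore] -/
theorem boostAt_posShift (u : EuclideanSpace ℝ d) (s t : ℝ) (y : Config N d (UnitAddTorus d)) :
    boostAt u s (fun i => ((y i).1 + FunctionSpaces.Torus.proj (t • u), (y i).2)) = boostAt u (s + t) y := by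
  funext i
  simp only [boostAt_apply, add_smul, FunctionSpaces.Torus.proj_add, Prod.mk.injEq, and_true]
  abel

/-- **A hard-sphere flow on the torus whose good set is invariant under all position translations commutes with
them on its good set, at all times** (forward uniqueness of trajectories forward in time, the group property
backward; `HardSphereFlow.flow_posShift_of_nonneg/neg`). [folklore] -/
theorem flow_posShift_of_good (Φ : HardSphereFlow (Torus.geometry d) ε N)
    (hgood : ∀ (a : UnitAddTorus d), ∀ z ∈ Φ.good,
      (fun i => ((z i).1 + a, (z i).2) : Config N d (UnitAddTorus d)) ∈ Φ.good)
    (a : UnitAddTorus d) {z : Config N d (UnitAddTorus d)} (hz : z ∈ Φ.good) (t : ℝ) :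
    Φ.flow t (fun i => ((z i).1 + a, (z i).2)) = fun i => ((Φ.flow t z i).1 + a, (Φ.flow t z i).2) := by
  rcases le_or_gt 0 t with ht | ht
  · exact Φ.flow_posShift_of_nonneg a hz (hgood a z hz) ht
  · exact Φ.flow_posShift_of_neg a hz ht (hgood a _ (Φ.mapsTo_good t hz))

/-- **THE GALILEAN-BOOSTED HARD-SPHERE FLOW** on the torus: `Φ^{(u)}_t = boostAt u t ∘ Φ_t ∘ boostAt (-u) 0`, a
hard-sphere flow for the SAME geometry and diameter with good set `boostAt u 0 '' Φ.good = boostAt (-u) 0 ⁻¹' Φ.good`,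
for a flow `Φ` whose good set is invariant under all position translations (then `Φ` commutes with them on the good
set, which is what the group law of the conjugate needs — see the module docstring for why this hypothesis cannot
be dropped). Orbits are the boosted orbits of `Φ` (`isHardSphereTrajectory_boostAt`); the Liouville measure is
preserved by each of `boostAt (-u) 0`, `Φ_t`, `boostAt u t`. -/
def boost (Φ : HardSphereFlow (Torus.geometry d) ε N) (u : EuclideanSpace ℝ d)
    (hgood : ∀ (a : UnitAddTorus d), ∀ z ∈ Φ.good,
      (fun i => ((z i).1 + a, (z i).2) : Config N d (UnitAddTorus d)) ∈ Φ.good) :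
    HardSphereFlow (Torus.geometry d) ε N where
  flow t z := boostAt u t (Φ.flow t (boostAt (-u) 0 z))
  good := boostAt (-u) 0 ⁻¹' Φ.good
  measurableSet_good := measurable_boostAt (-u) 0 Φ.measurableSet_good
  good_subset _ hz := boostAt_mem_hardSphereDomain_iff.1 (Φ.good_subset hz)
  measure_compl_good := by
    rw [← preimage_compl]
    exact liouville_preimage_boostAt_eq_zero ε (-u) 0 Φ.measurableSet_good.compl Φ.measure_compl_good
  mapsTo_good t z hz := by
    show boostAt (-u) 0 (boostAt u t (Φ.flow t (boostAt (-u) 0 z))) ∈ Φ.good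
    rw [boostAt_neg_zero_boostAt]
    exact hgood _ _ (Φ.mapsTo_good t hz)
  flow_zero z hz := by
    show boostAt u 0 (Φ.flow 0 (boostAt (-u) 0 z)) = z
    rw [Φ.flow_zero _ hz, boostAt_boostAt_neg]
  flow_add s t z hz := by
    show boostAt u (s + t) (Φ.flow (s + t) (boostAt (-u) 0 z)) =
      boostAt u s (Φ.flow s (boostAt (-u) 0 (boostAt u t (Φ.flow t (boostAt (-u) 0 z)))))
    rw [Φ.flow_add s t _ hz, boostAt_neg_zero_boostAt,
      flow_posShift_of_good Φ hgood _ (Φ.mapsTo_good t hz) s, boostAt_posShift]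
  measurable_flow t := (measurable_boostAt u t).comp ((Φ.measurable_flow t).comp (measurable_boostAt _ _))
  isTrajectory z hz := isHardSphereTrajectory_boostAt u (Φ.isTrajectory _ hz)
  measurePreserving t :=
    (measurePreserving_boostAt_liouville ε u t).comp
      ((Φ.measurePreserving t).comp (measurePreserving_boostAt_liouville ε (-u) 0))

variable (Φ : HardSphereFlow (Torus.geometry d) ε N) (u : EuclideanSpace ℝ d)
  (hgood : ∀ (a : UnitAddTorus d), ∀ z ∈ Φ.good,
    (fun i => ((z i).1 + a, (z i).2) : Config N d (UnitAddTorus d)) ∈ Φ.good)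

/-- The flow map of the boosted flow. [folklore] -/
@[simp]
theorem boost_flow (t : ℝ) (z : Config N d (UnitAddTorus d)) :
    (boost Φ u hgood).flow t z = boostAt u t (Φ.flow t (boostAt (-u) 0 z)) := rfl

/-- The good set of the boosted flow (preimage form). [folklore] -/
theorem boost_good : (boost Φ u hgood).good = boostAt (-u) 0 ⁻¹' Φ.good := rfl

/-- The good set of the boosted flow (image form): the velocity translate of the good set of `Φ`. [folklore] -/
theorem boost_good_eq_image : (boost Φ u hgood).good = boostAt u 0 '' Φ.good := by
  rw [boost_good, image_boostAt_eq_preimage]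

/-- Membership in the good set of the boosted flow. [folklore] -/
theorem mem_boost_good_iff {z : Config N d (UnitAddTorus d)} :
    z ∈ (boost Φ u hgood).good ↔ boostAt (-u) 0 z ∈ Φ.good := Iff.rfl

/-- `boostAt u 0` maps good data of `Φ` to good data of the boosted flow. [folklore] -/
theorem boostAt_mem_boost_good_iff {z : Config N d (UnitAddTorus d)} :
    boostAt u 0 z ∈ (boost Φ u hgood).good ↔ z ∈ Φ.good := by
  rw [mem_boost_good_iff, boostAt_neg_boostAt]

/-- **Conjugation identity**: `Φ^{(u)}_t (boostAt u 0 z) = boostAt u t (Φ_t z)` for every `z`. [folklore] -/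
theorem boost_flow_boostAt (t : ℝ) (z : Config N d (UnitAddTorus d)) :
    (boost Φ u hgood).flow t (boostAt u 0 z) = boostAt u t (Φ.flow t z) := by
  rw [boost_flow, boostAt_neg_boostAt]

/-- The orbits of the boosted flow are the boosted orbits of `Φ`. [folklore] -/
theorem boost_orbit (z : Config N d (UnitAddTorus d)) :
    (fun t => (boost Φ u hgood).flow t (boostAt u 0 z)) = fun t => boostAt u t (Φ.flow t z) := by
  funext t
  exact boost_flow_boostAt Φ u hgood t z

/-- The good set of the boosted flow is again invariant under all position translations (so boosts and thermal
rescalings can be iterated). [folklore] -/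
theorem boost_good_posShift (a : UnitAddTorus d) (z : Config N d (UnitAddTorus d)) (hz : z ∈ (boost Φ u hgood).good) :
    (fun i => ((z i).1 + a, (z i).2) : Config N d (UnitAddTorus d)) ∈ (boost Φ u hgood).good := by
  rw [mem_boost_good_iff] at hz ⊢
  have h := hgood a _ hz
  rw [boostAt_zero_right] at h ⊢
  simpa using h

/-- Boosting by `0` gives back the flow map. [folklore] -/
theorem boost_zero_flow : (boost Φ 0 hgood).flow = Φ.flow := by
  funext t z
  rw [boost_flow, neg_zero, boostAt_zero_left, boostAt_zero_left]

/-- Boosting by `0` gives back the good set. [folklore] -/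
theorem boost_zero_good : (boost Φ 0 hgood).good = Φ.good := by
  rw [boost_good, neg_zero]
  ext z
  rw [mem_preimage, boostAt_zero_left]

/-- Laws transported by the boosted flow, started from a `boostAt u 0`-image law: at time `t` the law is the
`boostAt u t`-image of the law of `Φ` at time `t`. [folklore] -/
theorem lawAt_boost_map (P₀ : Measure (Config N d (UnitAddTorus d))) (t : ℝ) :
    (boost Φ u hgood).lawAt (P₀.map (boostAt u 0)) t = (Φ.lawAt P₀ t).map (boostAt u t) := by
  rw [HardSphereFlow.lawAt_eq, HardSphereFlow.lawAt_eq, Measure.map_map ((boost Φ u hgood).measurable_flow t)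
    (measurable_boostAt u 0), Measure.map_map (measurable_boostAt u t) (Φ.measurable_flow t)]
  congr 1
  funext z
  exact boost_flow_boostAt Φ u hgood t z

/-- **Carried laws are carried**: `(boostAt u 0)_# P` gives the complement of the good set of the boosted flow the
mass `P` gives the complement of the good set of `Φ`. [folklore] -/
theorem map_boostAt_boost_good_compl (P : Measure (Config N d (UnitAddTorus d))) :
    P.map (boostAt u 0) (boost Φ u hgood).goodᶜ = P Φ.goodᶜ := by
  rw [Measure.map_apply (measurable_boostAt u 0) (boost Φ u hgood).measurableSet_good.compl, boost_good,
    ← preimage_compl, ← preimage_comp]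
  have : (boostAt (-u) 0 ∘ boostAt u 0 : Config N d (UnitAddTorus d) → Config N d (UnitAddTorus d)) = id :=
    funext fun z => boostAt_neg_boostAt u 0 z
  rw [this, preimage_id]

/-- **Window functionals along boosted orbits**: for every observable `F`,
`∫_a^b F (Φ^{(u)}_s (boostAt u 0 z)) ds = ∫_a^b F (boostAt u s (Φ_s z)) ds` — the window functional of the boosted
flow is the window functional of `Φ` for the MOVING observable `(s, z) ↦ F (boostAt u s z)`. [folklore] -/
theorem intervalIntegral_boost_flow {E : Type*} [NormedAddCommGroup E] [NormedSpace ℝ E]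
    (F : Config N d (UnitAddTorus d) → E) (z : Config N d (UnitAddTorus d)) (a b : ℝ) :
    ∫ s in a..b, F ((boost Φ u hgood).flow s (boostAt u 0 z)) = ∫ s in a..b, F (boostAt u s (Φ.flow s z)) := by
  simp only [boost_flow_boostAt]

/-- **Change of variables under the boost**: for a law `P` and a nonnegative functional `H` of the orbit,
`∫ H (orbit of Φ^{(u)} from z) d((boostAt u 0)_# P)(z) = ∫ H (boosted orbit of Φ from w) dP(w)`. [folklore] -/
theorem lintegral_boost_map (P : Measure (Config N d (UnitAddTorus d)))
    (H : (ℝ → Config N d (UnitAddTorus d)) → ℝ≥0∞) (hH : Measurable fun z => H fun t => (boost Φ u hgood).flow t z) :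
    ∫⁻ z, H (fun t => (boost Φ u hgood).flow t z) ∂P.map (boostAt u 0) =
      ∫⁻ w, H (fun t => boostAt u t (Φ.flow t w)) ∂P := by
  rw [lintegral_map hH (measurable_boostAt u 0)]
  simp only [boost_flow_boostAt]

end Flow

/-! ### The statement: boosts of flows with translation-invariant good set -/

/-- **GALILEAN BOOSTS OF HARD-SPHERE FLOWS ON THE TORUS (exact form).** For every hard-sphere flow `Φ` on `𝕋ᵈ`
(diameter `ε`, `N` particles) WHOSE GOOD SET IS INVARIANT UNDER ALL POSITION TRANSLATIONS
`(x_i, v_i)_i ↦ (x_i + a, v_i)_i`, and every `u ∈ ℝᵈ`, there is a hard-sphere flow `Ψ` (same geometry, same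
diameter) with `Ψ_t z = boostAt u t (Φ_t (boostAt (-u) 0 z))` for all `t, z` and good set `boostAt u 0 '' Φ.good`.
This is the CORRECTED form of the lead's registered `BoostFlow` (which had no hypothesis on `Φ` and is false for
the abstract structure `HardSphereFlow`: module docstring, the frozen-junk counterexample with `N = 1`); the
hypothesis holds for the canonical (Alexander) flow `Alexander.regHardSphereFlow`, with which every flow agrees
Liouville-a.e. (see the layer-3 file `…KineticWindowGronwallBoostRegular` for the unconditional a.e. form).
Folklore (Galilean invariance; the Liouville measure is boost-invariant). -/
def BoostFlowOfInvariantGood : Prop :=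
  ∀ {d : Type*} [Fintype d] {ε : ℝ} {N : ℕ} (Φ : HardSphereFlow (Torus.geometry d) ε N) (u : EuclideanSpace ℝ d),
    (∀ (a : UnitAddTorus d), ∀ z ∈ Φ.good, (fun i => ((z i).1 + a, (z i).2) : Config N d (UnitAddTorus d)) ∈ Φ.good) →
    ∃ Ψ : HardSphereFlow (Torus.geometry d) ε N,
      (∀ t z, Ψ.flow t z = boostAt u t (Φ.flow t (boostAt (-u) 0 z))) ∧ Ψ.good = boostAt u 0 '' Φ.good

/-- **Layer 2, proved** (witness `boost`). [folklore] -/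
theorem boostFlow_of_invariantGood : BoostFlowOfInvariantGood := by
  intro d _ ε N Φ u hgood
  exact ⟨boost Φ u hgood, fun t z => rfl, boost_good_eq_image Φ u hgood⟩

/-- **The torus case** `𝕋³ × ℝ³` in the form used by the frame covariance: for every hard-sphere flow on the flat
3-torus with translation-invariant good set and every `u` there is a hard-sphere flow `Ψ` with
`Ψ_t z = boostAt u t (Φ_t (boostAt (-u) 0 z))`. [folklore] -/
theorem boostFlow_torus (ε : ℝ) (N : ℕ) (Φ : HardSphereFlow (Torus.geometry (Fin 3)) ε N)
    (hgood : ∀ (a : UnitAddTorus (Fin 3)), ∀ z ∈ Φ.good,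
      (fun i => ((z i).1 + a, (z i).2) : Config N (Fin 3) (UnitAddTorus (Fin 3))) ∈ Φ.good)
    (u : EuclideanSpace ℝ (Fin 3)) :
    ∃ Ψ : HardSphereFlow (Torus.geometry (Fin 3)) ε N,
      ∀ t z, Ψ.flow t z = boostAt u t (Φ.flow t (boostAt (-u) 0 z)) :=
  ⟨boost Φ u hgood, fun _ _ => rfl⟩

end Summit.AtomisticToContinuum.HydrodynamicLimit.Theorems.KineticWindowGronwallBoost

end
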